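/-
Copyright (c) 2026. All rights reserved.
Released under Apache 2.0 license as described in the file LICENSE.
Authors: abc-iut cell, prover seat abc-iut-w5-d172 (wave 5, gen 2).
-/
import Literature.IUT.LogVolume.UnitLogIntoMaximalIdeal
import Literature.IUT.LogVolume.WildCubicUnitLog
import Literature.IUT.LogVolume.PadicSubfields
import Literature.IUT.LogVolume.FundamentalIdentity
import HarnessLib

/-!
# Wild ramification `e = 4` over `ℚ₃`: the logarithm of a unit is NEVER a unit (`‖log₃ u‖ ∈ {3^{1/4}} ∪ [0, 3^{−1/2}]`)

Proof-only companion (theorems, no definitions) of `UnitLogIntoMaximalIdeal.lean` (abc-iut-w5-d172 gen 0: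
`e ≤ p − 1 ⇒ log_p(𝒪_K^×) ⊆ 𝔪_K`) and `WildCubicUnitLogUnit.lean` (gen 2: at `e = p = 3` with `π³ = 3`,
`log₃(1+π)` IS a unit).  Here: the OTHER wild phenomenon — for a complete ultrametric normed `ℚ₃`-algebra field
`K` of absolute ramification index EXACTLY `e = 4` (`> p − 1 = 2`), NO unit has a unit logarithm, although
`log₃(𝒪_K^×) ⊄ 𝔪_K`.  Classical local arithmetic (Neukirch, *Algebraic Number Theory*, Ch. II (5.5)): a
principal unit `y` has `‖1 − y‖ = 3^{−m/4}`, `m ≥ 1`; for `m = 1` the cubic term `(1−y)³/3` of the logarithmic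
series has norm `3^{1/4} > 1` and STRICTLY dominates every other term (index `n ≠ 3` has `4·v₃(n) + 1 ≤ n`), so
`‖L(y)‖ = 3^{1/4}`; for `m ≥ 2` every term has norm `≤ 3^{−1/2}` (`2·v₃(n) + 1 ≤ n`), so `‖L(y)‖ ≤ 3^{−1/2}`;
a general unit reduces to a principal power `u^k`, `3 ∤ k`, `‖k⁻¹‖ = 1`.

* `norm_logSeries_eq_inv_of_norm_eq` — `‖1 − y‖ = s`, `s⁴ = 1/3` ⇒ `‖L(y)‖ = s⁻¹ (= 3^{1/4})`;
* `norm_logSeries_le_of_norm_le_of_sq` — `‖1 − y‖ ≤ r`, `r² = 1/3` ⇒ `‖L(y)‖ ≤ r (= 3^{−1/2})`;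
* **`norm_unitLog_ne_one_of_absRamificationIdx_eq_four`** — `e(K/ℚ₃) = 4 ⇒ ‖log₃ u‖ ≠ 1` for every `u`;
* `logUnits_inter_sphere_eq_empty_of_absRamificationIdx_eq_four`,
  `unitLog_image_logUnits_inter_sphere_eq_empty_of_absRamificationIdx_eq_four` — `log₃(𝒪_K^×)` MISSES the
  unit sphere, so the second iterate of `log₃` on units has EMPTY domain — exactly as in the tame range
  `e ≤ p − 1`, although `e = 4 ≥ p = 3`.

* `exists_absRamificationIdx_eq_four` — the hypothesis is inhabited: `E = ℚ₃(∜3) ⊆ ℚ̄₃` has `e = 4`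
  (`e ≤ [E : ℚ₃] ≤ 4` by the fundamental identity, `e ≥ 4` since `‖∜3‖ = 3^{−1/4} ≤ 3^{−1/e}`).

So the sufficient condition `e ≤ p − 1` of `UnitLogIntoMaximalIdeal.logUnits_inter_sphere_eq_empty` is sharp
(`WildCubicUnitLogUnit`) but NOT necessary: whether `log_p(𝒪_K^×)` meets `𝒪_K^×` is not a function of `e`
versus `p` alone.  Nothing here is disputed mathematics; no IUT statement is asserted.
-/

noncomputable section

open Metric Set

namespace Literature.IUT.LogVolume

namespace WildQuartic

variable {K : Type*} [NontriviallyNormedField K] [NormedAlgebra ℚ_[3] K]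

/-! ## Arithmetic of the indices: `2·v₃(n) + 1 ≤ n`, and `4·v₃(n) + 1 ≤ n` for `n ≠ 3` -/

/-- `3^t ≥ 2t + 1`. [folklore] -/
private theorem two_mul_add_one_le_three_pow (t : ℕ) : 2 * t + 1 ≤ 3 ^ t := by
  induction t with
  | zero => norm_num
  | succ t ih => rw [pow_succ]; omega

/-- `2·s + 1 ≤ n` whenever `3^s ∣ n ≠ 0`. [folklore] -/
private theorem two_mul_add_one_le {n s : ℕ} (hn : n ≠ 0) (h : 3 ^ s ∣ n) : 2 * s + 1 ≤ n :=
  (two_mul_add_one_le_three_pow s).trans (Nat.le_of_dvd (Nat.pos_of_ne_zero hn) h)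

/-- `4·s + 1 ≤ n` whenever `3^s ∣ n`, `n ≠ 0` and `n ≠ 3` (the cubic index is the ONLY exception). [folklore] -/
private theorem four_mul_add_one_le {n s : ℕ} (hn : n ≠ 0) (hn3 : n ≠ 3) (h : 3 ^ s ∣ n) : 4 * s + 1 ≤ n := by
  have hle : 3 ^ s ≤ n := Nat.le_of_dvd (Nat.pos_of_ne_zero hn) h
  rcases s with _ | _ | s
  · omega
  · -- `s = 1`: `n = 3t` with `t ≥ 2`
    obtain ⟨t, rfl⟩ := h
    rw [pow_one] at hle ⊢
    omega
  · have key : ∀ t : ℕ, 4 * (t + 2) + 1 ≤ 3 ^ (t + 2) := by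
      intro t
      induction t with
      | zero => norm_num
      | succ t ih => rw [pow_succ]; omega
    exact (key s).trans hle

/-! ## Sizes of the terms of the logarithmic series -/

/-- If `‖x‖ ≤ r` with `r² = 1/3` then EVERY term of the logarithmic series has norm `≤ r`:
`‖x^{n}/n‖ ≤ r^{n}·3^{v₃(n)} ≤ r^{2v₃(n)+1}·3^{v₃(n)} = r`. [cite: NeukirchANT1999, Ch. II (5.5)] -/
theorem norm_logTerm_le_of_norm_le_of_sq {r : ℝ} (hr : 0 < r) (hr2 : r ^ 2 = 3⁻¹) {x : K}
    (hx : ‖x‖ ≤ r) (n : ℕ) : ‖-(x ^ (n + 1)) / (n + 1 : K)‖ ≤ r := by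
  have hr1 : r ≤ 1 := (pow_le_one_iff_of_nonneg hr.le (by norm_num : (2 : ℕ) ≠ 0)).mp (by rw [hr2]; norm_num)
  have hkey : ∀ v : ℕ, r ^ (2 * v + 1) * (3 : ℝ) ^ v = r := fun v => by
    rw [pow_succ, pow_mul, hr2, mul_right_comm, ← mul_pow, inv_mul_cancel₀ (by norm_num : (3 : ℝ) ≠ 0),
      one_pow, one_mul]
  refine (WildCubic.norm_logTerm_le x n).trans ?_
  have hv := two_mul_add_one_le (n := n + 1) (s := padicValNat 3 (n + 1)) (by omega) pow_padicValNat_dvd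
  calc ‖x‖ ^ (n + 1) * (3 : ℝ) ^ padicValNat 3 (n + 1)
      ≤ r ^ (n + 1) * (3 : ℝ) ^ padicValNat 3 (n + 1) := by gcongr
    _ ≤ r ^ (2 * padicValNat 3 (n + 1) + 1) * (3 : ℝ) ^ padicValNat 3 (n + 1) := by
        gcongr ?_ * _
        exact pow_le_pow_of_le_one hr.le hr1 hv
    _ = r := hkey _

/-- If `‖x‖ ≤ s` with `s⁴ = 1/3` then every term of index `n ≠ 3` has norm `≤ s`:
`‖x^{n}/n‖ ≤ s^{n}·3^{v₃(n)} ≤ s^{4v₃(n)+1}·3^{v₃(n)} = s`. [cite: NeukirchANT1999, Ch. II (5.5)] -/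
theorem norm_logTerm_le_of_norm_le_of_pow_four {s : ℝ} (hs : 0 < s) (hs4 : s ^ 4 = 3⁻¹) {x : K}
    (hx : ‖x‖ ≤ s) {n : ℕ} (hn : n + 1 ≠ 3) : ‖-(x ^ (n + 1)) / (n + 1 : K)‖ ≤ s := by
  have hs1 : s ≤ 1 := (pow_le_one_iff_of_nonneg hs.le (by norm_num : (4 : ℕ) ≠ 0)).mp (by rw [hs4]; norm_num)
  have hkey : ∀ v : ℕ, s ^ (4 * v + 1) * (3 : ℝ) ^ v = s := fun v => by
    rw [pow_succ, pow_mul, hs4, mul_right_comm, ← mul_pow, inv_mul_cancel₀ (by norm_num : (3 : ℝ) ≠ 0),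
      one_pow, one_mul]
  refine (WildCubic.norm_logTerm_le x n).trans ?_
  have hv := four_mul_add_one_le (n := n + 1) (s := padicValNat 3 (n + 1)) (by omega) hn pow_padicValNat_dvd
  calc ‖x‖ ^ (n + 1) * (3 : ℝ) ^ padicValNat 3 (n + 1)
      ≤ s ^ (n + 1) * (3 : ℝ) ^ padicValNat 3 (n + 1) := by gcongr
    _ ≤ s ^ (4 * padicValNat 3 (n + 1) + 1) * (3 : ℝ) ^ padicValNat 3 (n + 1) := by
        gcongr ?_ * _
        exact pow_le_pow_of_le_one hs.le hs1 hv
    _ = s := hkey _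

/-- The cubic term: `‖x‖ = s`, `s⁴ = 1/3` ⇒ `‖x³/3‖ = s³·3 = s⁻¹`. [cite: NeukirchANT1999, Ch. II (5.5)] -/
theorem norm_cubicTerm_eq {s : ℝ} (hs4 : s ^ 4 = 3⁻¹) {x : K} (hx : ‖x‖ = s) :
    ‖-(x ^ (2 + 1)) / (2 + 1 : K)‖ = s⁻¹ := by
  rw [norm_div, norm_neg, norm_pow, hx, show ((2 : K) + 1) = 3 by norm_num, WildCubic.norm_three]
  apply eq_inv_of_mul_eq_one_left
  calc s ^ (2 + 1) / 3⁻¹ * s = s ^ 4 * 3 := by rw [div_inv_eq_mul]; ring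
    _ = 1 := by rw [hs4, inv_mul_cancel₀ (by norm_num : (3 : ℝ) ≠ 0)]

variable [IsUltrametricDist K]

/-- **`‖1 − y‖ ≤ r`, `r² = 1/3` ⇒ `‖L(y)‖ ≤ r`** (ultrametric bound for the series, term by term).
[cite: NeukirchANT1999, Ch. II (5.5)] -/
theorem norm_logSeries_le_of_norm_le_of_sq {r : ℝ} (hr : 0 < r) (hr2 : r ^ 2 = 3⁻¹) {y : K}
    (hy : ‖1 - y‖ ≤ r) : ‖logSeries y‖ ≤ r :=
  norm_logSeries_le hr.le fun n => norm_logTerm_le_of_norm_le_of_sq hr hr2 hy n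

variable [CompleteSpace K]

/-- **`‖1 − y‖ = s`, `s⁴ = 1/3` ⇒ `‖L(y)‖ = s⁻¹`**: the cubic term (norm `s⁻¹ > 1`) strictly dominates the sum
of all the others (each of norm `≤ s < 1`). [cite: NeukirchANT1999, Ch. II (5.5)] -/
theorem norm_logSeries_eq_inv_of_norm_eq {s : ℝ} (hs : 0 < s) (hs4 : s ^ 4 = 3⁻¹) {y : K}
    (hy : ‖1 - y‖ = s) : ‖logSeries y‖ = s⁻¹ := by
  have hs1 : s < 1 := (pow_lt_one_iff_of_nonneg hs.le (by norm_num : (4 : ℕ) ≠ 0)).mp (by rw [hs4]; norm_num)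
  have hsinv : s < s⁻¹ := hs1.trans (one_lt_inv_iff₀.mpr ⟨hs, hs1⟩)
  set x : K := 1 - y with hxdef
  set f : ℕ → K := fun n => -(x ^ (n + 1)) / (n + 1 : K) with hfdef
  have hsum : HasSum f (logSeries y) := hasSum_logSeries 3 (by rw [← hxdef, hy]; exact hs1)
  have htail := (hasSum_nat_add_iff' 3).mpr hsum
  -- the tail `T = L(y) − (f 0 + f 1 + f 2)` has norm `≤ s`
  have hT : ‖logSeries y - ∑ i ∈ Finset.range 3, f i‖ ≤ s := by
    rw [← htail.tsum_eq]
    refine IsUltrametricDist.norm_tsum_le_of_forall_le_of_nonneg hs.le fun n => ?_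
    exact norm_logTerm_le_of_norm_le_of_pow_four hs hs4 hy.le (by omega)
  have h0 : ‖f 0‖ ≤ s := norm_logTerm_le_of_norm_le_of_pow_four hs hs4 hy.le (by omega)
  have h1 : ‖f 1‖ ≤ s := norm_logTerm_le_of_norm_le_of_pow_four hs hs4 hy.le (by omega)
  have h2 : ‖f 2‖ = s⁻¹ := norm_cubicTerm_eq hs4 hy
  have hsplit : logSeries y = f 2 + (f 0 + f 1 + (logSeries y - ∑ i ∈ Finset.range 3, f i)) := by
    rw [Finset.sum_range_succ, Finset.sum_range_succ, Finset.sum_range_succ, Finset.sum_range_zero]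
    ring
  have hrest : ‖f 0 + f 1 + (logSeries y - ∑ i ∈ Finset.range 3, f i)‖ ≤ s :=
    (IsUltrametricDist.norm_add_le_max _ _).trans (max_le
      ((IsUltrametricDist.norm_add_le_max _ _).trans (max_le h0 h1)) hT)
  rw [hsplit, IsUltrametricDist.norm_add_eq_max_of_norm_ne_norm (by rw [h2]; exact (hrest.trans_lt hsinv).ne'),
    h2]
  exact max_eq_left (hrest.trans hsinv.le)

/-! ## `e = 4`: the logarithm of a unit is never a unit -/

/-- `(3^{−1/4})⁴ = 1/3` and `(3^{−1/2})² = 1/3`. [folklore] -/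
private theorem rpow_neg_quarter_pow_four : ((3 : ℝ) ^ (-(1 / 4 : ℝ))) ^ 4 = 3⁻¹ ∧
    ((3 : ℝ) ^ (-(1 / 2 : ℝ))) ^ 2 = 3⁻¹ := by
  constructor
  · rw [← Real.rpow_natCast, ← Real.rpow_mul (by norm_num)]
    norm_num [Real.rpow_neg_one]
  · rw [← Real.rpow_natCast, ← Real.rpow_mul (by norm_num)]
    norm_num [Real.rpow_neg_one]

variable [ProperSpace K]

/-- **In absolute ramification `e(K/ℚ₃) = 4`, a principal unit `y` has `‖L(y)‖ ≠ 1`**: `‖1 − y‖ = 3^{−m/4}`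
with `m ≥ 1` (value group `3^{(1/4)ℤ}`, abc-iut-S1's `exists_norm_eq_rpow`); `m = 1` gives `‖L(y)‖ = 3^{1/4}`,
`m ≥ 2` gives `‖L(y)‖ ≤ 3^{−1/2}`. [cite: NeukirchANT1999, Ch. II (5.5)] -/
theorem norm_logSeries_ne_one_of_absRamificationIdx_eq_four (he : absRamificationIdx 3 K = 4) {y : K}
    (hy : IsPrincipal y) : ‖logSeries y‖ ≠ 1 := by
  obtain ⟨hs4, hr2⟩ := rpow_neg_quarter_pow_four
  have hspos : (0 : ℝ) < (3 : ℝ) ^ (-(1 / 4 : ℝ)) := Real.rpow_pos_of_pos (by norm_num) _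
  have hrpos : (0 : ℝ) < (3 : ℝ) ^ (-(1 / 2 : ℝ)) := Real.rpow_pos_of_pos (by norm_num) _
  have hr1 : (3 : ℝ) ^ (-(1 / 2 : ℝ)) < 1 :=
    Real.rpow_lt_one_of_one_lt_of_neg (by norm_num) (by norm_num)
  by_cases hx : 1 - y = 0
  · -- `y = 1`: `L(1) = 0`
    have : y = 1 := (sub_eq_zero.mp hx).symm
    rw [this, logSeries_one, norm_zero]
    exact zero_ne_one
  obtain ⟨m, hm⟩ := exists_norm_eq_rpow 3 K hx
  rw [he] at hm
  have hm1 : 1 ≤ m := by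
    by_contra hlt
    have hle : (0 : ℝ) ≤ -((m : ℝ) / ((4 : ℕ) : ℝ)) := by
      have hm0 : m ≤ 0 := by omega
      have : (m : ℝ) ≤ 0 := by exact_mod_cast hm0
      push_cast
      linarith
    have h1 : (1 : ℝ) ≤ ‖1 - y‖ := by rw [hm]; exact Real.one_le_rpow (by norm_num) hle
    exact absurd hy (not_lt.mpr h1)
  rcases hm1.eq_or_lt with h1 | h2
  · -- `m = 1`: the cubic term dominates, `‖L(y)‖ = 3^{1/4} > 1`
    have hnorm : ‖1 - y‖ = (3 : ℝ) ^ (-(1 / 4 : ℝ)) := by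
      rw [hm, ← h1]; norm_num
    rw [norm_logSeries_eq_inv_of_norm_eq hspos hs4 hnorm]
    have hs1 : (3 : ℝ) ^ (-(1 / 4 : ℝ)) < 1 :=
      Real.rpow_lt_one_of_one_lt_of_neg (by norm_num) (by norm_num)
    exact (one_lt_inv_iff₀.mpr ⟨hspos, hs1⟩).ne'
  · -- `m ≥ 2`: every term is `≤ 3^{−1/2} < 1`
    have hle : ‖1 - y‖ ≤ (3 : ℝ) ^ (-(1 / 2 : ℝ)) := by
      rw [hm]
      refine Real.rpow_le_rpow_of_exponent_le (by norm_num) ?_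
      have : (2 : ℝ) ≤ m := by exact_mod_cast h2
      push_cast
      linarith
    exact ((norm_logSeries_le_of_norm_le_of_sq hrpos hr2 hle).trans_lt hr1).ne

/-- **`e(K/ℚ₃) = 4` ⇒ the `3`-adic logarithm of a unit is never a unit: `‖log₃ u‖ ≠ 1` for every `u : K`**
(for a unit, `log₃ u = k⁻¹·L(u^k)` with `u^k` principal, `3 ∤ k`, `‖k⁻¹‖ = 1`; the junk value `0` otherwise).
Contrast: `e ≤ 2 ⇒ ‖log₃ u‖ < 1` (`UnitLogIntoMaximalIdeal`), `e = 3` with `π³ = 3 ⇒ ‖log₃(1+π)‖ = 1`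
(`WildCubicUnitLogUnit`). [cite: NeukirchANT1999, Ch. II (5.5)] -/
theorem norm_unitLog_ne_one_of_absRamificationIdx_eq_four (he : absRamificationIdx 3 K = 4) (u : K) :
    ‖unitLog u‖ ≠ 1 := by
  by_cases hu : ‖u‖ = 1
  · obtain ⟨k, hk0, hk3, hkP⟩ := exists_pow_isPrincipal_not_dvd (p := 3) hu
    rw [unitLog_eq_inv_mul_logSeries 3 hk0 hkP, norm_mul, norm_inv, norm_natCast_eq_one_of_not_dvd 3 hk3,
      inv_one, one_mul]
    exact norm_logSeries_ne_one_of_absRamificationIdx_eq_four he hkP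
  · rw [unitLog_of_norm_ne_one hu, norm_zero]
    exact zero_ne_one

/-- **`log₃(𝒪_K^×)` misses the unit sphere when `e(K/ℚ₃) = 4`** — the same conclusion as
`UnitLogIntoMaximalIdeal.logUnits_inter_sphere_eq_empty` (`e ≤ p − 1`), at a wildly ramified `e = 4 ≥ p = 3`.
[cite: NeukirchANT1999, Ch. II (5.5)] -/
theorem logUnits_inter_sphere_eq_empty_of_absRamificationIdx_eq_four (he : absRamificationIdx 3 K = 4) :
    logUnits K ∩ sphere 0 1 = ∅ := by
  ext z
  simp only [mem_inter_iff, mem_sphere_zero_iff_norm, mem_empty_iff_false, iff_false, not_and]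
  rintro ⟨u, -, rfl⟩
  exact norm_unitLog_ne_one_of_absRamificationIdx_eq_four he u

/-- … so the SECOND iterate of `log₃` on units has empty domain and image at `e = 4`.
[cite: NeukirchANT1999, Ch. II (5.5)] -/
theorem unitLog_image_logUnits_inter_sphere_eq_empty_of_absRamificationIdx_eq_four
    (he : absRamificationIdx 3 K = 4) : unitLog '' (logUnits K ∩ sphere 0 1) = ∅ := by
  rw [logUnits_inter_sphere_eq_empty_of_absRamificationIdx_eq_four he, image_empty]


/-! ## The hypothesis `e = 4` is inhabited: `ℚ₃(∜3) ⊆ ℚ̄₃` -/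

open Polynomial IntermediateField in
/-- **A finite extension of `ℚ₃` with `e = 4`**: `E = ℚ₃(α) ⊆ ℚ̄₃`, `α⁴ = 3` (`ℚ̄₃` is algebraically closed).
`[E : ℚ₃] ≤ 4` (the minimal polynomial of `α` divides `X⁴ − 3`), so `e ≤ e·f = [E : ℚ₃] ≤ 4` (abc-iut-S1's
fundamental identity `absRamificationIdx_mul_residueDegree`); and `‖α‖⁴ = ‖3‖ = 1/3`, `‖α‖ < 1 ⇒ ‖α‖ ≤ 3^{−1/e}`
(discreteness, `norm_le_rpow_of_norm_lt_one`) forces `e ≥ 4`.  No irreducibility argument is needed.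
[cite: NeukirchANT1999, Ch. II (5.5)] -/
theorem exists_absRamificationIdx_eq_four :
    ∃ (E : IntermediateField ℚ_[3] (PadicAlgCl 3)) (_ : FiniteDimensional ℚ_[3] E),
      absRamificationIdx 3 E = 4 := by
  obtain ⟨α, hα⟩ := IsAlgClosed.exists_pow_nat_eq (3 : PadicAlgCl 3) (by norm_num : 0 < 4)
  have h3 : algebraMap ℚ_[3] (PadicAlgCl 3) 3 = 3 := map_ofNat _ 3
  have heval : Polynomial.aeval α (X ^ 4 - C (3 : ℚ_[3])) = 0 := by
    simp [hα, h3]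
  have hint : IsIntegral ℚ_[3] α := ⟨X ^ 4 - C 3, monic_X_pow_sub_C 3 (by norm_num), by
    simpa [Polynomial.aeval_def] using heval⟩
  haveI hfd : FiniteDimensional ℚ_[3] ℚ_[3]⟮α⟯ := adjoin.finiteDimensional hint
  have hπ : (⟨α, mem_adjoin_simple_self ℚ_[3] α⟩ : ℚ_[3]⟮α⟯) ^ 4 = 3 := by
    apply Subtype.ext
    have h3E : ((3 : ℚ_[3]⟮α⟯) : PadicAlgCl 3) = 3 := map_ofNat (algebraMap ℚ_[3]⟮α⟯ (PadicAlgCl 3)) 3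
    simp [hα, h3E]
  refine ⟨ℚ_[3]⟮α⟯, hfd, ?_⟩
  set π : ℚ_[3]⟮α⟯ := ⟨α, mem_adjoin_simple_self ℚ_[3] α⟩ with hπdef
  -- `[E : ℚ₃] ≤ 4`
  have hdeg : Module.finrank ℚ_[3] ℚ_[3]⟮α⟯ ≤ 4 := by
    rw [adjoin.finrank hint]
    have hdvd : minpoly ℚ_[3] α ∣ X ^ 4 - C 3 := minpoly.dvd ℚ_[3] α heval
    have hne : (X ^ 4 - C (3 : ℚ_[3])) ≠ 0 := (monic_X_pow_sub_C 3 (by norm_num)).ne_zero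
    calc (minpoly ℚ_[3] α).natDegree ≤ (X ^ 4 - C (3 : ℚ_[3])).natDegree := natDegree_le_of_dvd hdvd hne
      _ = 4 := natDegree_X_pow_sub_C
  -- `e ≤ 4` from `e·f = [E : ℚ₃]`, `f ≥ 1`
  have hef := absRamificationIdx_mul_residueDegree 3 (ℚ_[3]⟮α⟯ : Type _)
  have hf := residueDegree_pos 3 (ℚ_[3]⟮α⟯ : Type _)
  have hele : absRamificationIdx 3 ℚ_[3]⟮α⟯ ≤ 4 :=
    (Nat.le_mul_of_pos_right _ hf).trans (hef.trans_le hdeg)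
  -- `e ≥ 4` from `‖α‖⁴ = 1/3` and discreteness `‖α‖ ≤ 3^{−1/e}`
  have hnorm4 : ‖π‖ ^ 4 = 3⁻¹ := by rw [← norm_pow, hπ, WildCubic.norm_three]
  have hπlt : ‖π‖ < 1 :=
    (pow_lt_one_iff_of_nonneg (norm_nonneg _) (by norm_num : (4 : ℕ) ≠ 0)).mp (by rw [hnorm4]; norm_num)
  have hdisc := norm_le_rpow_of_norm_lt_one 3 (ℚ_[3]⟮α⟯ : Type _) hπlt
  set e := absRamificationIdx 3 ℚ_[3]⟮α⟯ with hedef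
  have he0 : (0 : ℝ) < e := by exact_mod_cast absRamificationIdx_pos 3 (ℚ_[3]⟮α⟯ : Type _)
  have h4 : ‖π‖ ^ 4 ≤ ((3 : ℝ) ^ (-(1 / (e : ℝ)))) ^ 4 := pow_le_pow_left₀ (norm_nonneg _) hdisc 4
  rw [hnorm4, ← Real.rpow_natCast, ← Real.rpow_mul (by norm_num), ← Real.rpow_neg_one,
    Real.rpow_le_rpow_left_iff (by norm_num : (1 : ℝ) < 3)] at h4
  -- `h4 : -1 ≤ -(1/e) * 4`, i.e. `4/e ≤ 1`
  have hege : (4 : ℝ) ≤ e := by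
    have h := mul_le_mul_of_nonneg_right h4 he0.le
    field_simp at h
    push_cast at h
    nlinarith
  have hege' : 4 ≤ e := by exact_mod_cast hege
  omega

end WildQuartic

end Literature.IUT.LogVolume

end
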